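import Literature.IUT.LogThetaLattice.HodgeTheaterLogLink
import Literature.IUT.LogThetaLattice.BiCoresProp12Proofs
import HarnessLib

/-!
# [IUTchIII] Proposition 1.3 (iii): the strip log-links of a log-link of Hodge theaters and Prop 1.2 (ii)–(ix)
# (proof-only junction companion of `HodgeTheaterLogLink.lean` and `BiCores.lean`)

S. Mochizuki, *Inter-universal Teichmüller Theory III*, kurims manuscript (May 2020), §1, Proposition 1.3
(iii), p. 42 l. 44–48 [claim: Mochizuki2012, status: disputed], verbatim: "(iii) (Further Properties of the
log-Link) In the notation of (i), any log-link `†HT^{Θ±ellNF} --log--> ‡HT^{Θ±ellNF}` satisfies, for each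
`F`-prime-strip `†F_□`, properties corresponding to the properties of Proposition 1.2, (ii), (iii), (iv),
(v), (vi), (vii), (viii), (ix), i.e., concerning simultaneous compatibility with ring structures and
log-volumes, Kummer theory, and log-shells." Printed proof (p. 43 l. 23–24): "The various assertions of
Proposition 1.3 follow immediately from the definitions and the references quoted in the statements of
these assertions."

Status of the typing of record. abc-iut-L6-t3's `HodgeTheaterLogLink.lean` (p406456) types a log-link of
`Θ^{±ell}NF`-Hodge theaters as the datum `Ξ` (`HTLogLink`) and DERIVES, at every label `□`, the log-link of
`F`-prime-strips `†F_□ --log--> ‡F_□` (`HTLogLink.stripLink`, a `LogLink` in the sense of Def 1.1 (iii),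
`LogLink.lean` p405502); its header (l. 57–59) records that Prop 1.3 (iii) "is the conjunction of [Prop 1.2
(ii)–(ix)] strip by strip and is not given a separate decl". Prop 1.2 (ii)–(v) are typed and proved at the
level of ONE place `v` over the local models (`HolomorphicLogShells.lean` p404642, `HolomorphicLogShellsProofs.lean`
p406453, `LocalLogShells.lean` p403834: e.g. `LogLinkVolumeCompatible` / `logLinkVolumeCompatible_ofUnitLog`
(iii), `log_ne_self_of_mem_principalUnits` (iv), `isCompact_logShell_ofUnitLog` /
`nonzeroIntegers_subset_logShell'` / `preLogShell_subset_logShell_ofUnitLog`, `isCompact_arcLogShell` /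
`arcIntegers_subset_complexLogShell` / `sphere_subset_exp_complexLogShell` (v); (ii) = Galois-equivariance of
the logarithm, `Literature.AnabelianGeometry.AbsoluteAnabelian.GaloisPadicLog.log_smul`) — statements
quantified over EVERY local field, hence valid verbatim at the place `v` of any `†F_□`; they are cited by name
and not restated here. Prop 1.2 (vi)–(ix) are typed at the level of an `F`-prime-strip over the interface
`BiCoricData` (`BiCores.lean` p406839, `BiCoresProp12Proofs.lean` p411776): the composite [poly-]isomorphisms
`log(†D^⊢) ⥲ log(†F^{⊢×μ}) ⥲ log(†F)` (`BiCoricData.monoHolAt`, `monoHolAt'`), their nonemptiness and the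
"compatible with one another" containment in the `Ism`-orbit built from `†F^{⊢×μ}` alone
(`monoHolAt_subset_orbit`), and the coric holomorphic log-shells `*D ↦ I_{*D}` with the natural isomorphisms
`I_{*D^⊢} ⥲ I_{*D}` (`coricHolShell`, `coricIsoAt`).

THIS PROOF-ONLY FILE (abc-iut cell, block C / wave W6, CONE-BOARD row IUTchIII:Prop1.3(iii); no definition,
no new `Prop`, the typers' files untouched) records the JUNCTION print asserts in (iii), at exactly the level
at which the Prop 1.2 items are typed, for an ARBITRARY log-link of Hodge theaters `Λ : HTLogLink L X Y`, an
arbitrary `B : BiCoricData S` and every label `□`: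

* `HTLogLink.stripLink_coricHolShell_eq` — Prop 1.2 (ix) ("a functorial algorithm in the `D`-prime-strip
  `*D` for constructing … coric holomorphic log-shells `I_{*D}`") applied along Prop 1.2 (i) for the strip
  log-link `†F_□ --log--> ‡F_□` (its induced poly-isomorphism `†D_□ ⥲ ‡D_□`): the induced poly-isomorphism
  `I_{†D_□} ⥲ I_{‡D_□}` of coric holomorphic log-shells is `{I(D(ξ)_□) | ξ ∈ Ξ}` — the shells are carried
  along exactly the isomorphisms of `D`-prime-strips determined by `Ξ` (Prop 1.3 (ii), t3's
  `stripLink_inducedD`); `…_nonempty`; `…_full` (the full log-link = the vertical arrows of Def 1.4);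
* **`HTLogLink.prop13iii`** — the conjunction, for the strip `□` of `Λ`, of: the transport statement above;
  Prop 1.2 (vi)–(viii) at `†F_□` AND at `‡F_□` (nonempty composites `log(D^⊢) ⥲ log(F^{⊢×μ}) ⥲ log(F)`, inside
  the `Ism`-orbit; primed composite nonempty); Prop 1.2 (ix) at `†D_□` and `‡D_□` (`I_{D^⊢} ⥲ I_{D}` nonempty)
  — ONE kernel name for the node, so that the cell's kernel index (`Summits/ABC/IUTFork/DAGL6t.lean`) can key
  `N_IUTchIII_Prop1_3_iii` to a statement about [IUTchIII] (at the time of writing it is keyed, by a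
  token-resolution accident, to `Literature.AnabelianGeometry.AbsoluteAnabelian.DPSCData.Prop13iii`, which is
  [AbsTopII] Prop 1.3 (iii)).

Honest framing: bookkeeping over the interfaces `StripFrame` / `LogStripData` / `BiCoricData`; every proof
is an instantiation of a landed theorem; nothing here asserts a disputed claim, nothing takes a side on
[IUTchIII] Cor. 3.12; typed ≠ discharged elsewhere. Deliberately NOT here: the model-level items (ii)–(v)
(no frame functor `†F_□ ↦ (local log-Frobenius data)_v` exists to instantiate them IN the strip variable; the
real-frame vocabulary is `LogKit.log v`, `LogStripOfKits.lean` p413352); the capsule labels `□ ∈ J ⊔ T` at the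
REAL frame `StripFrame.ofKits` (SUBDAG-IUTchIII-Prop-13 row i.r2a, owner L6-t3 / L5-t4).
-/

namespace Literature.IUT.LogThetaLattice

open CategoryTheory
open Literature.IUT.HodgeTheaters

universe u

namespace HTLogLink

variable {S : StripFrame.{u}} {L : LogStripData S} (B : BiCoricData S) {X Y : S.HT}

/-! ### Prop 1.3 (iii) ↔ Prop 1.2 (ix), (i): coric holomorphic log-shells along a strip log-link -/

/-- **IUTchIII:Prop1.3(iii)** (kurims p.42) with Prop 1.2 (ix) p.34 ("a functorial algorithm in the
`D`-prime-strip `*D` for constructing … coric holomorphic log-shells `I_{*D}`") and Prop 1.2 (i) p.31: for a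
log-link of Hodge theaters `Λ` (datum `Ξ`) and a label `□`, the poly-isomorphism of coric holomorphic
log-shells `I_{†D_□} ⥲ I_{‡D_□}` induced by the strip log-link `†F_□ --log--> ‡F_□` (through its induced
poly-isomorphism of `D`-prime-strips) consists of the images of the isomorphisms `D(ξ)_□ : †D_□ ⥲ ‡D_□`,
`ξ ∈ Ξ` — the strip log-links lie over `Ξ` (Prop 1.3 (ii)). [claim: Mochizuki2012, status: disputed] -/
theorem stripLink_coricHolShell_eq (Λ : HTLogLink L X Y) (l : S.Label) :
    ((Λ.stripLink l).inducedD).map B.coricHolShell =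
      (fun ξ => B.coricHolShell.mapIso (dstripIso ξ l)) '' Λ.Ξ := by
  rw [stripLink_inducedD, PolyIso.map, Set.image_image]

/-- **IUTchIII:Prop1.3(iii)** (kurims p.42) membership form of `stripLink_coricHolShell_eq`: an isomorphism
`I_{†D_□} ⥲ I_{‡D_□}` of coric holomorphic log-shells is induced by the strip log-link at `□` iff it is
`I(D(ξ)_□)` for some constituent `ξ ∈ Ξ`. [claim: Mochizuki2012, status: disputed] -/
theorem mem_stripLink_coricHolShell_iff (Λ : HTLogLink L X Y) (l : S.Label)
    (e : B.coricHolShell.obj (S.toD.obj ((S.strip l).obj X)) ≅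
      B.coricHolShell.obj (S.toD.obj ((S.strip l).obj Y))) :
    e ∈ ((Λ.stripLink l).inducedD).map B.coricHolShell ↔
      ∃ ξ ∈ Λ.Ξ, B.coricHolShell.mapIso (dstripIso ξ l) = e := by
  rw [stripLink_coricHolShell_eq, Set.mem_image]

/-- **IUTchIII:Prop1.3(iii)** (kurims p.42) with Prop 1.2 (ix): the induced poly-isomorphism of coric
holomorphic log-shells `I_{†D_□} ⥲ I_{‡D_□}` along the strip log-link at `□` is a NONEMPTY collection of
isomorphisms (a log-link of Hodge theaters has a constituent). [claim: Mochizuki2012, status: disputed] -/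
theorem stripLink_coricHolShell_nonempty (Λ : HTLogLink L X Y) (l : S.Label) :
    (((Λ.stripLink l).inducedD).map B.coricHolShell).Nonempty :=
  ((Λ.stripLink l).inducedD_nonempty).image _

/-- **IUTchIII:Prop1.3(iii)** (kurims p.42) for the FULL log-link of Hodge theaters (the vertical arrows
of the log-theta-lattice, Def 1.4): the coric holomorphic log-shells at `□` are related by the images of ALL
isomorphisms `D(ξ)_□`, `ξ : †HT^D ⥲ ‡HT^D`. [claim: Mochizuki2012, status: disputed] -/
theorem stripLink_coricHolShell_full (L : LogStripData S) (X Y : S.HT) (l : S.Label) :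
    (((full L X Y).stripLink l).inducedD).map B.coricHolShell =
      Set.range (fun ξ : S.htToD.obj X ≅ S.htToD.obj Y => B.coricHolShell.mapIso (dstripIso ξ l)) := by
  rw [stripLink_coricHolShell_eq, ← Set.image_univ]
  rfl

/-! ### Prop 1.3 (iii): the junction, one kernel name -/

/-- **IUTchIII:Prop1.3(iii)** (kurims p.42) **Prop 1.3 (iii) (Further Properties of the log-Link)** at the
level at which Prop 1.2 (vi)–(ix) are typed (interface `BiCoricData`; the model-level items (ii)–(v) hold
for every local field and are cited in the module docstring): for ANY log-link of `Θ^{±ell}NF`-Hodge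
theaters `Λ : †HT --log--> ‡HT` and each label `□` — (a) [Prop 1.2 (i), (ix)] the coric holomorphic
log-shells `I_{†D_□} ⥲ I_{‡D_□}` are transported along the strip log-link `†F_□ --log--> ‡F_□`, by a nonempty
poly-isomorphism lying over `Ξ`; (b) [Prop 1.2 (vi), (vii), (viii) at `†F_□`] the composite
[poly-]isomorphism `log(†D^⊢_□) ⥲ log(†F^{⊢×μ}_□) ⥲ log(†F_□)` / `I_{†D^⊢_□} ⥲ I_{†F^{⊢×μ}_□} ⥲ I_{†F_□}` is a nonempty
collection, "compatible with one another" (inside the `Ism`-orbit constructed from `†F^{⊢×μ}_□` alone), and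
so is the primed composite with `†D^⊢_□ = D^⊢(D(†F_□))`; (c) the same at `‡F_□`; (d) [Prop 1.2 (ix)] the
natural isomorphisms `I_{†D^⊢_□} ⥲ I_{†D_□}` and `I_{‡D^⊢_□} ⥲ I_{‡D_□}` of coric holomorphic log-shells are nonempty
collections. [claim: Mochizuki2012, status: disputed] -/
theorem prop13iii (Λ : HTLogLink L X Y) (l : S.Label) :
    ((((Λ.stripLink l).inducedD).map B.coricHolShell).Nonempty ∧
      ((Λ.stripLink l).inducedD).map B.coricHolShell =
        (fun ξ => B.coricHolShell.mapIso (dstripIso ξ l)) '' Λ.Ξ) ∧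
    ((B.monoHolAt ((S.strip l).obj X)).Nonempty ∧
      B.monoHolAt ((S.strip l).obj X) ⊆
        (B.monoFxm (S.toFxm.obj ((S.strip l).obj X))).comp (B.fxmHol ((S.strip l).obj X)) ∧
      (B.monoHolAt' ((S.strip l).obj X)).Nonempty) ∧
    ((B.monoHolAt ((S.strip l).obj Y)).Nonempty ∧
      B.monoHolAt ((S.strip l).obj Y) ⊆
        (B.monoFxm (S.toFxm.obj ((S.strip l).obj Y))).comp (B.fxmHol ((S.strip l).obj Y)) ∧
      (B.monoHolAt' ((S.strip l).obj Y)).Nonempty) ∧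
    ((B.coricIsoAt (S.toD.obj ((S.strip l).obj X))).Nonempty ∧
      (B.coricIsoAt (S.toD.obj ((S.strip l).obj Y))).Nonempty) :=
  ⟨⟨stripLink_coricHolShell_nonempty B Λ l, stripLink_coricHolShell_eq B Λ l⟩,
    ⟨B.monoHolAt_nonempty _, B.monoHolAt_subset_orbit _, B.monoHolAt'_nonempty _⟩,
    ⟨B.monoHolAt_nonempty _, B.monoHolAt_subset_orbit _, B.monoHolAt'_nonempty _⟩,
    ⟨B.coricIsoAt_nonempty _, B.coricIsoAt_nonempty _⟩⟩

/-- **IUTchIII:Prop1.3(iii)** (kurims p.42) "for each `F`-prime-strip `†F_□`": the junction holds at every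
label simultaneously (all of `>`, `≻`, `j ∈ J`, `t ∈ T` the frame provides). [claim: Mochizuki2012, status: disputed] -/
theorem prop13iii_all (Λ : HTLogLink L X Y) :
    ∀ l : S.Label,
      (((Λ.stripLink l).inducedD).map B.coricHolShell).Nonempty ∧
        (B.monoHolAt ((S.strip l).obj X)).Nonempty ∧ (B.monoHolAt ((S.strip l).obj Y)).Nonempty ∧
        (B.coricIsoAt (S.toD.obj ((S.strip l).obj X))).Nonempty ∧
        (B.coricIsoAt (S.toD.obj ((S.strip l).obj Y))).Nonempty :=
  fun l => ⟨stripLink_coricHolShell_nonempty B Λ l, B.monoHolAt_nonempty _, B.monoHolAt_nonempty _,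
    B.coricIsoAt_nonempty _, B.coricIsoAt_nonempty _⟩

end HTLogLink

end Literature.IUT.LogThetaLattice
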